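import Literature.MathematicalPhysics.QuantumFieldTheory.Balaban1983to89.BalabanAdmissibleClassParams
import Literature.MathematicalPhysics.QuantumFieldTheory.Balaban1983to89.T3ThresholdSmallness
import HarnessLib

/-!
# Crux `FluctuationComparisonRegPrIntL` (stmt-QuantumFields-20520), LINE «run-pair organ» (ym-r3-idea-1 g15) — FC, part 1/2:
# the ABSTRACT FINITE BACKWARD CHAIN and the one-height termination

Pure real analysis behind the finite chain «FC» (`stub_finiteChain`) of the skeleton
`Cruxes/FluctuationComparisonRegPrIntL/Lines/runpair_organ.lean` (v5/v6): `finiteChain_core` (Grönwall + telescoping with a quadratic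
feedback over a FINITE range of heights, marginal-unit weights `m i`; the pattern of the landed 23158
`backwardLiouvilleRigidity_backwardChainLemmaAdm_proof`, p660990), the reflected-loss-sum bound, the two threshold facts the card's
sketch uses silently (`p(g_T) ≥ b₀`, so the top weight is `≤ θ/b₀²`; `β_jθBal_j²/θ ≤ 2β_j#Plaq_j` for `j ≥ j₂`), and `osc_of_datum` (the
one-bond oscillation read off a `(c, a, w)` datum through the degenerate four-point instance `(U, V, U, U)`).  Part 2/2
(`…RunPairOrganFiniteChain.lean`) instantiates this for the two repaired forms of FC.  Width seat `ym-line-sfw-p2-w3` g32 (cell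
`ym-idea-1`, free hands, R3 family).  HONEST FRAMING: glue only; no organ, crux, rung or summit is proved; `YM3TorusSU2` and the Yang–Mills
mass gap are NOT proved.
-/

set_option autoImplicit false

open MeasureTheory Filter Topology
open scoped BigOperators
open Literature.MathematicalPhysics.QuantumFieldTheory.Balaban1983to89 T3ContinuumYM3Torus
  T3UnitLawDensityEML T4Continuum BalabanUVClass T3UnitScaleTilt

namespace Summit.QuantumFields.YangMills.Theorems.FluctuationComparisonRegPrIntL.RunPairOrgan

/-! ## The abstract chain (pure real analysis) -/

/-- ABSTRACT FINITE BACKWARD CHAIN (Grönwall + telescoping with a quadratic feedback; the pattern of p660990).  Heights `i`, data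
predicates `D i a w`, marginal weights `m i ≥ 0`, potential `V = a + m i · w`; a top datum at `T` with `V_T ≤ B`; a one-step map
`i+1 → i` (for `j ≤ i < T`, under the side condition `V ≤ w₀`) with factor `1 + e i + C·V` and floor `δ i`; if `Σ_{[j,T)} e ≤ E`,
`e^{E+1}(B + Σ_{k≥j} δ_k) ≤ w₀` and `C·e^{E+1}((T−j)·B + Σ_i Σ_k δ_{k+i+j}) ≤ 1`, then a datum at `j` exists with
`V_j ≤ e^{E+1}(B + Σ_{k≥j} δ_k)`. [folklore] -/
theorem finiteChain_core (D : ℕ → ℝ → ℝ → Prop) (m e δ : ℕ → ℝ) (C w₀ B E : ℝ) (j T : ℕ)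
    (hm : ∀ i, 0 ≤ m i) (he : ∀ i, 0 ≤ e i) (hδ : ∀ i, 0 ≤ δ i) (hC : 0 ≤ C) (hB : 0 ≤ B)
    (hδs : Summable δ) (hDs : Summable (fun i => ∑' k, δ (k + i)))
    (hE : ∑ k ∈ Finset.Ico j T, e k ≤ E) (hjT : j ≤ T)
    (htop : ∃ a w, 0 ≤ a ∧ 0 ≤ w ∧ a + m T * w ≤ B ∧ D T a w)
    (hstep : ∀ i, j ≤ i → i + 1 ≤ T → ∀ a w, 0 ≤ a → 0 ≤ w → a + m (i + 1) * w ≤ w₀ → D (i + 1) a w →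
      ∃ a' w', 0 ≤ a' ∧ 0 ≤ w' ∧
        a' + m i * w' ≤ (1 + e i + C * (a + m (i + 1) * w)) * (a + m (i + 1) * w) + δ i ∧ D i a' w')
    (hsmall : Real.exp (E + 1) * (B + ∑' k, δ (k + j)) ≤ w₀)
    (hquad : C * (Real.exp (E + 1) * (((T - j : ℕ) : ℝ) * B + ∑' i, ∑' k, δ (k + (i + j)))) ≤ 1) :
    ∃ a w, 0 ≤ a ∧ 0 ≤ w ∧ a + m j * w ≤ Real.exp (E + 1) * (B + ∑' k, δ (k + j)) ∧ D j a w := by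
  classical
  have hG : 0 < Real.exp (E + 1) := Real.exp_pos _
  have hDnn : ∀ i : ℕ, 0 ≤ ∑' k, δ (k + i) := fun i => tsum_nonneg fun k => hδ _
  have hDsucc : ∀ i : ℕ, ∑' k, δ (k + i) = δ i + ∑' k, δ (k + (i + 1)) := by
    intro i
    have hs : Summable (fun k => δ (k + i)) := (summable_nat_add_iff (f := δ) i).mpr hδs
    rw [hs.tsum_eq_zero_add]
    simp only [zero_add]
    congr 1
    exact tsum_congr fun k => by rw [show k + 1 + i = k + (i + 1) by omega]
  have hDanti : ∀ i : ℕ, ∑' k, δ (k + (i + 1)) ≤ ∑' k, δ (k + i) := fun i => by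
    rw [hDsucc i]; linarith [hδ i]
  have hDmono : Antitone (fun i : ℕ => ∑' k, δ (k + i)) := antitone_nat_of_succ_le hDanti
  have hsumD : ∀ i : ℕ, j ≤ i → ∑ n ∈ Finset.Ico i T, (∑' k, δ (k + (n + 1))) ≤ (∑' i, ∑' k, δ (k + (i + j))) := by
    intro i hji
    have hDs' : Summable (fun n => ∑' k, δ (k + (n + j))) :=
      (summable_nat_add_iff (f := fun i => ∑' k, δ (k + i)) j).mpr hDs
    calc ∑ n ∈ Finset.Ico i T, (∑' k, δ (k + (n + 1)))
        ≤ ∑ k ∈ Finset.Ico i T, ∑' m, δ (m + k) := Finset.sum_le_sum fun k _ => hDanti k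
      _ ≤ ∑ k ∈ Finset.Ico j T, ∑' m, δ (m + k) :=
          Finset.sum_le_sum_of_subset_of_nonneg (Finset.Ico_subset_Ico hji le_rfl) fun k _ _ => hDnn k
      _ = ∑ n ∈ Finset.range (T - j), ∑' m, δ (m + (j + n)) := Finset.sum_Ico_eq_sum_range _ _ _
      _ = ∑ n ∈ Finset.range (T - j), ∑' m, δ (m + (n + j)) := by
          refine Finset.sum_congr rfl fun n _ => ?_
          rw [Nat.add_comm j n]
      _ ≤ (∑' i, ∑' k, δ (k + (i + j))) := hDs'.sum_le_tsum _ fun n _ => hDnn _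
  have hsume : ∀ i : ℕ, j ≤ i → ∑ k ∈ Finset.Ico i T, e k ≤ E := fun i hji =>
    (Finset.sum_le_sum_of_subset_of_nonneg (Finset.Ico_subset_Ico hji le_rfl) fun k _ _ => he k).trans hE
  -- the accumulated exponent from height `i` up to the top
  set X : ℕ → ℝ := fun i => ∑ k ∈ Finset.Ico i T, e k +
    C * (Real.exp (E + 1) * (((T - i : ℕ) : ℝ) * B + ∑ n ∈ Finset.Ico i T, (∑' k, δ (k + (n + 1))))) with hX
  have hEXPO : ∀ i : ℕ, j ≤ i → X i ≤ E + 1 := by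
    intro i hji
    have h1 := hsume i hji
    have hTi : ((T - i : ℕ) : ℝ) ≤ ((T - j : ℕ) : ℝ) := by exact_mod_cast Nat.sub_le_sub_left hji T
    have h3 : ((T - i : ℕ) : ℝ) * B + ∑ n ∈ Finset.Ico i T, (∑' k, δ (k + (n + 1))) ≤
        ((T - j : ℕ) : ℝ) * B + (∑' i, ∑' k, δ (k + (i + j))) :=
      add_le_add (mul_le_mul_of_nonneg_right hTi hB) (hsumD i hji)
    have h2 : C * (Real.exp (E + 1) * (((T - i : ℕ) : ℝ) * B + ∑ n ∈ Finset.Ico i T, (∑' k, δ (k + (n + 1))))) ≤ 1 :=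
      le_trans (mul_le_mul_of_nonneg_left (mul_le_mul_of_nonneg_left h3 hG.le) hC) hquad
    simp only [hX]
    linarith
  have hXnn : ∀ i : ℕ, 0 ≤ X i := fun i =>
    add_nonneg (Finset.sum_nonneg fun k _ => he k)
      (mul_nonneg hC (mul_nonneg hG.le (add_nonneg (mul_nonneg (Nat.cast_nonneg _) hB)
        (Finset.sum_nonneg fun n _ => hDnn (n + 1)))))
  have claim : ∀ n : ℕ, ∀ i : ℕ, i + n = T → j ≤ i →
      ∃ a w, 0 ≤ a ∧ 0 ≤ w ∧ a + m i * w ≤ Real.exp (X i) * (B + ∑' k, δ (k + i)) ∧ D i a w := by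
    intro n
    induction n with
    | zero =>
      intro i hi hji
      have hiT : i = T := by omega
      subst hiT
      obtain ⟨a, w, ha, hw, hV, hD⟩ := htop
      refine ⟨a, w, ha, hw, ?_, hD⟩
      calc a + m i * w ≤ B := hV
        _ = 1 * B := (one_mul _).symm
        _ ≤ Real.exp (X i) * (B + ∑' k, δ (k + i)) :=
          mul_le_mul (Real.one_le_exp (hXnn i)) (le_add_of_nonneg_right (hDnn i)) hB (Real.exp_pos _).le
    | succ n ih =>
      intro i hi hji
      have hiT : i + 1 ≤ T := by omega
      obtain ⟨a, w, ha, hw, hVb, hD⟩ := ih (i + 1) (by omega) (by omega)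
      have hVnn : 0 ≤ a + m (i + 1) * w := add_nonneg ha (mul_nonneg (hm _) hw)
      have hx1 : 0 ≤ B + ∑' k, δ (k + (i + 1)) := add_nonneg hB (hDnn _)
      have hB1 : a + m (i + 1) * w ≤ Real.exp (E + 1) * (B + ∑' k, δ (k + (i + 1))) :=
        hVb.trans (mul_le_mul_of_nonneg_right (Real.exp_le_exp.mpr (hEXPO (i + 1) (by omega))) hx1)
      have hside : a + m (i + 1) * w ≤ w₀ := by
        have hD' : (∑' k, δ (k + (i + 1))) ≤ (∑' k, δ (k + j)) := hDmono (show j ≤ i + 1 by omega)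
        have : Real.exp (E + 1) * (B + ∑' k, δ (k + (i + 1))) ≤ Real.exp (E + 1) * (B + ∑' k, δ (k + j)) :=
          mul_le_mul_of_nonneg_left (by linarith) hG.le
        exact hB1.trans (this.trans hsmall)
      obtain ⟨a', w', ha', hw', hV', hD'⟩ := hstep i hji hiT a w ha hw hside hD
      refine ⟨a', w', ha', hw', ?_, hD'⟩
      -- the one-step factor is absorbed into the exponent
      set Y : ℝ := e i + C * (Real.exp (E + 1) * (B + ∑' k, δ (k + (i + 1)))) with hY
      have hYnn : 0 ≤ Y := add_nonneg (he i) (mul_nonneg hC (mul_nonneg hG.le hx1))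
      have hfac : 1 + e i + C * (a + m (i + 1) * w) ≤ Real.exp Y := by
        have h1 : C * (a + m (i + 1) * w) ≤ C * (Real.exp (E + 1) * (B + ∑' k, δ (k + (i + 1)))) :=
          mul_le_mul_of_nonneg_left hB1 hC
        have h2 := Real.add_one_le_exp Y
        simp only [hY] at h2 ⊢
        linarith
      have hXsucc : X i = Y + X (i + 1) := by
        have hiT' : i < T := hiT
        have hIcoe : ∑ k ∈ Finset.Ico i T, e k = e i + ∑ k ∈ Finset.Ico (i + 1) T, e k :=
          Finset.sum_eq_sum_Ico_succ_bot hiT' _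
        have hIcoD : ∑ n ∈ Finset.Ico i T, (∑' k, δ (k + (n + 1))) =
            (∑' k, δ (k + (i + 1))) + ∑ n ∈ Finset.Ico (i + 1) T, (∑' k, δ (k + (n + 1))) :=
          Finset.sum_eq_sum_Ico_succ_bot hiT' (fun n => (∑' k, δ (k + (n + 1))))
        have hsub : ((T - i : ℕ) : ℝ) = ((T - (i + 1) : ℕ) : ℝ) + 1 := by
          have : (T - i : ℕ) = (T - (i + 1)) + 1 := by omega
          rw [this]; push_cast; ring
        simp only [hX, hY]
        rw [hIcoe, hIcoD, hsub]; ring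
      have hprod : 1 ≤ Real.exp Y * Real.exp (X (i + 1)) := by
        rw [← Real.exp_add]
        exact Real.one_le_exp (add_nonneg hYnn (hXnn (i + 1)))
      calc a' + m i * w' ≤ (1 + e i + C * (a + m (i + 1) * w)) * (a + m (i + 1) * w) + δ i := hV'
        _ ≤ Real.exp Y * (Real.exp (X (i + 1)) * (B + ∑' k, δ (k + (i + 1)))) + δ i := by
            have := mul_le_mul hfac hVb hVnn (Real.exp_pos _).le
            linarith
        _ ≤ Real.exp Y * Real.exp (X (i + 1)) * (B + ∑' k, δ (k + (i + 1)) + δ i) := by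
            have hδ' : δ i ≤ Real.exp Y * Real.exp (X (i + 1)) * δ i := le_mul_of_one_le_left (hδ i) hprod
            have hring : Real.exp Y * (Real.exp (X (i + 1)) * (B + ∑' k, δ (k + (i + 1)))) + δ i
                = Real.exp Y * Real.exp (X (i + 1)) * (B + ∑' k, δ (k + (i + 1)) + δ i)
                  - (Real.exp Y * Real.exp (X (i + 1)) * δ i - δ i) := by ring
            rw [hring]; linarith [hδ']
        _ = Real.exp (X i) * (B + ∑' k, δ (k + i)) := by
            rw [← Real.exp_add, hXsucc, hDsucc i]; ring
  obtain ⟨a, w, ha, hw, hVb, hD⟩ := claim (T - j) j (by omega) le_rfl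
  exact ⟨a, w, ha, hw, hVb.trans (mul_le_mul_of_nonneg_right (Real.exp_le_exp.mpr (hEXPO j le_rfl))
    (add_nonneg hB (hDnn j))), hD⟩

/-! ## Small facts about the thresholds, the plaquette count and the reflected loss sums -/

/-- `b₀ ≤ p(g)` for `0 < g ≤ 1`, `b₀ > 0`, `p₀ > 0` (`p(g) = b₀(1 + log g⁻¹)^{p₀}` and `1 + log g⁻¹ ≥ 1`). [cite: Balaban1985UV3, (7) p.257] -/
theorem b₀_le_pFun {b₀ p₀ g : ℝ} (hb₀ : 0 < b₀) (hp₀ : 0 < p₀) (hg : 0 < g) (hg1 : g ≤ 1) :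
    b₀ ≤ B10.pFun b₀ p₀ g := by
  unfold B10.pFun
  have hlog : 0 ≤ Real.log g⁻¹ := Real.log_nonneg ((one_le_inv₀ hg).mpr hg1)
  have h1 : (1 : ℝ) ≤ (1 + Real.log g⁻¹) ^ p₀ := Real.one_le_rpow (by linarith) hp₀.le
  calc b₀ = b₀ * 1 := (mul_one _).symm
    _ ≤ b₀ * (1 + Real.log g⁻¹) ^ p₀ := mul_le_mul_of_nonneg_left h1 hb₀.le

/-- The marginal weight at the top is at most `θ/b₀²`: `θ/(β_T·θBal_T²) = θ/p(g_T)² ≤ θ/b₀²` (`0 < γ ≤ 1`, `b₀, p₀, θ > 0`).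
[cite: Balaban1985UV3, (7) p.257] -/
theorem marginalWeight_le (F : T3Family) {γ b₀ p₀ θ : ℝ} (hγ : 0 < γ) (hγ1 : γ ≤ 1) (hb₀ : 0 < b₀) (hp₀ : 0 < p₀)
    (hθ : 0 ≤ θ) (T : ℕ) :
    θ / ((F.L : ℝ) ^ T / γ * θBal F.L γ b₀ p₀ T ^ 2) ≤ θ / b₀ ^ 2 := by
  have hL1 : (1 : ℝ) ≤ F.L := by exact_mod_cast F.hL.2.le
  have hLi : 0 < ((F.L : ℝ)⁻¹) ^ T := pow_pos (inv_pos.mpr (by linarith)) T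
  have hLi1 : ((F.L : ℝ)⁻¹) ^ T ≤ 1 := pow_le_one₀ (inv_nonneg.mpr (by linarith)) (inv_le_one_of_one_le₀ hL1)
  have hg : 0 < Real.sqrt (γ * ((F.L : ℝ)⁻¹) ^ T) := Real.sqrt_pos.mpr (mul_pos hγ hLi)
  have hg1 : Real.sqrt (γ * ((F.L : ℝ)⁻¹) ^ T) ≤ 1 := Real.sqrt_le_one.mpr (by nlinarith)
  have hp := b₀_le_pFun hb₀ hp₀ hg hg1
  rw [← AdmissibleClassParams.pFun_sq_eq F hγ b₀ p₀ T]
  exact div_le_div_of_nonneg_left hθ (by positivity) (pow_le_pow_left₀ hb₀.le hp 2)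

/-- There is at least one plaquette on every torus of the family (`d = 3`). [folklore] -/
theorem one_le_card_plaq (F : T3Family) (j : ℕ) : (1 : ℝ) ≤ (Fintype.card (Plaq (F.P j) 0) : ℝ) := by
  have h : 0 < Fintype.card (Plaq (F.P j) 0) :=
    Fintype.card_pos_iff.mpr ⟨⟨default, ⟨0, by simp⟩, ⟨1, by simp⟩, Fin.mk_lt_mk.mpr zero_lt_one⟩⟩
  exact_mod_cast h

/-- EVENTUAL THRESHOLD: for `j ≥ j₂(F, γ, b₀, p₀, θ)` one has `β_j θBal_j²/θ ≤ 2β_j·#Plaq_j` (`θBal_j → 0`, `#Plaq_j ≥ 1`), i.e. the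
irrelevant one-bond budget `w ≤ V·p_j²/θ` is dominated by the marginal one. [cite: Balaban1985UV3, (7) p.257] -/
theorem exists_threshold_height (F : T3Family) {γ b₀ θ : ℝ} (hγ : 0 < γ) (hγ1 : γ ≤ 1) (hb₀ : 0 < b₀) (hθ : 0 < θ)
    (p₀ : ℝ) :
    ∃ j₂ : ℕ, ∀ j : ℕ, j₂ ≤ j →
      (F.L : ℝ) ^ j / γ * θBal F.L γ b₀ p₀ j ^ 2 / θ ≤ 2 * ((F.L : ℝ) ^ j / γ) * (Fintype.card (Plaq (F.P j) 0) : ℝ) := by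
  have ht := T3ThresholdSmallness.tendsto_θBal_atTop F.hL.2 hγ b₀ p₀
  have hpos : (0 : ℝ) < min 1 (2 * θ) := lt_min one_pos (by linarith)
  obtain ⟨j₂, hj₂⟩ := eventually_atTop.1 (ht.eventually (ge_mem_nhds hpos))
  refine ⟨j₂, fun j hj => ?_⟩
  have hle : θBal F.L γ b₀ p₀ j ≤ min 1 (2 * θ) := hj₂ j hj
  have h0 : 0 ≤ θBal F.L γ b₀ p₀ j :=
    (T3MinimiserStabilityReduction.θBal_pos (L := F.L) F.hL.2.le hγ hγ1 hb₀ p₀ j).le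
  have hβ : 0 ≤ (F.L : ℝ) ^ j / γ := by positivity
  have hsq : θBal F.L γ b₀ p₀ j ^ 2 ≤ 2 * θ := by
    have h1 : θBal F.L γ b₀ p₀ j ≤ 1 := hle.trans (min_le_left _ _)
    have h2 : θBal F.L γ b₀ p₀ j ≤ 2 * θ := hle.trans (min_le_right _ _)
    nlinarith
  have hcard := one_le_card_plaq F j
  calc (F.L : ℝ) ^ j / γ * θBal F.L γ b₀ p₀ j ^ 2 / θ
      = ((F.L : ℝ) ^ j / γ) * (θBal F.L γ b₀ p₀ j ^ 2 / θ) := by ring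
    _ ≤ ((F.L : ℝ) ^ j / γ) * (2 * 1) := by
        refine mul_le_mul_of_nonneg_left ?_ hβ
        rw [div_le_iff₀ hθ]; linarith
    _ ≤ ((F.L : ℝ) ^ j / γ) * (2 * (Fintype.card (Plaq (F.P j) 0) : ℝ)) := by gcongr
    _ = 2 * ((F.L : ℝ) ^ j / γ) * (Fintype.card (Plaq (F.P j) 0) : ℝ) := by ring

/-- Reflected partial sums of a nonnegative summable sequence are below its sum: `Σ_{k∈[j,T)} f(T−(k+1)) ≤ Σ' f`. [folklore] -/
theorem sum_Ico_reflect_le_tsum {f : ℕ → ℝ} (hf : ∀ n, 0 ≤ f n) (hfs : Summable f) (j T : ℕ) :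
    ∑ k ∈ Finset.Ico j T, f (T - (k + 1)) ≤ ∑' n, f n := by
  rcases le_or_gt j T with hjT | hjT
  · calc ∑ k ∈ Finset.Ico j T, f (T - (k + 1))
        = ∑ i ∈ Finset.range (T - j), f (T - (j + i + 1)) := by
          rw [Finset.sum_Ico_eq_sum_range]
      _ = ∑ i ∈ Finset.range (T - j), f (T - j - 1 - i) :=
          Finset.sum_congr rfl fun i _ => by congr 1; omega
      _ = ∑ i ∈ Finset.range (T - j), f i := Finset.sum_range_reflect f (T - j)
      _ ≤ ∑' n, f n := hfs.sum_le_tsum _ fun n _ => hf n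
  · rw [Finset.Ico_eq_empty (by omega), Finset.sum_empty]
    exact tsum_nonneg hf

/-! ## Termination at one height: the one-bond oscillation from a `(c, a, w)` datum -/

/-- From a datum `(c, a, w)` at height `j` with potential `a + (θ/p_j²)·w ≤ W` and the threshold `p_j²/θ ≤ 2β_j#Plaq_j`: the one-bond
oscillation of `log ρ − log ρ'` on the window is `≤ 2W·(1/θ' + 2β_j#Plaq_j)` for every `θ' > 0` (the four-point clause is used in its
degenerate instance `(U, V, U, U)`, the marginal part costs `2aβ_j#Plaq_j`). [folklore] -/
theorem osc_of_datum (F : T3Family) {γ b₀ p₀ κ θ θ' Wt : ℝ} {j : ℕ}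
    (ρ ρ' : GaugeField (F.P j) 0 ↥(Matrix.specialUnitaryGroup (Fin 2) ℂ) → ℝ)
    (c : Plaq (F.P j) 0 → ℝ) {a w : ℝ} (ha : 0 ≤ a) (hw : 0 ≤ w) (hγ : 0 < γ) (hκ : 0 ≤ κ) (hθ' : 0 < θ') (hWt : 0 ≤ Wt)
    (hm : 0 < θ / ((F.L : ℝ) ^ j / γ * θBal F.L γ b₀ p₀ j ^ 2))
    (hV : a + θ / ((F.L : ℝ) ^ j / γ * θBal F.L γ b₀ p₀ j ^ 2) * w ≤ Wt)
    (hthr : (F.L : ℝ) ^ j / γ * θBal F.L γ b₀ p₀ j ^ 2 / θ ≤ 2 * ((F.L : ℝ) ^ j / γ) * (Fintype.card (Plaq (F.P j) 0) : ℝ))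
    (hc : ∀ p, |c p| ≤ a)
    (h4 : (∀ (b b' : PBond (F.P j) 0) U V W Z, PlaqSmall (θBal F.L γ b₀ p₀ j) U → PlaqSmall (θBal F.L γ b₀ p₀ j) V → PlaqSmall (θBal F.L γ b₀ p₀ j) W → PlaqSmall (θBal F.L γ b₀ p₀ j) Z → (∀ e, e ≠ b → U e = V e) → (∀ e, e ≠ b' → U e = W e) → (∀ e, e ≠ b' → V e = Z e) → (∀ e, e ≠ b → W e = Z e) → |(Real.log (ρ U) - Real.log (ρ' U) - ((F.L : ℝ) ^ j / γ) * ∑ p, c p * (1 - reTr (GaugeField.plaqHol U p))) - (Real.log (ρ V) - Real.log (ρ' V) - ((F.L : ℝ) ^ j / γ) * ∑ p, c p * (1 - reTr (GaugeField.plaqHol V p))) - ((Real.log (ρ W) - Real.log (ρ' W) - ((F.L : ℝ) ^ j / γ) * ∑ p, c p * (1 - reTr (GaugeField.plaqHol W p))) - (Real.log (ρ Z) - Real.log (ρ' Z) - ((F.L : ℝ) ^ j / γ) * ∑ p, c p * (1 - reTr (GaugeField.plaqHol Z p))))| ≤ w * Real.exp (-(κ * (b.src.tdist b'.src : ℝ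)))))
    (b : PBond (F.P j) 0) (U V : GaugeField (F.P j) 0 ↥(Matrix.specialUnitaryGroup (Fin 2) ℂ))
    (hU : PlaqSmall (θBal F.L γ b₀ p₀ j) U) (hVV : PlaqSmall (θBal F.L γ b₀ p₀ j) V) (hUV : ∀ e, e ≠ b → U e = V e) :
    |(Real.log (ρ U) - Real.log (ρ' U)) - (Real.log (ρ V) - Real.log (ρ' V))| ≤
      2 * Wt * (1 / θ' + 2 * ((F.L : ℝ) ^ j / γ) * (Fintype.card (Plaq (F.P j) 0) : ℝ)) := by
  classical
  set β : ℝ := (F.L : ℝ) ^ j / γ with hβdef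
  set P : ℝ := (Fintype.card (Plaq (F.P j) 0) : ℝ) with hPdef
  set psq : ℝ := β * θBal F.L γ b₀ p₀ j ^ 2 with hpsq
  have hβ : 0 ≤ β := by simp only [hβdef]; positivity
  have hP : 0 ≤ P := by positivity
  -- budgets: `w ≤ Wt·(p²/θ) ≤ Wt·2βP`, `a ≤ Wt`
  have hqw : θ / psq * w ≤ Wt := le_trans (le_add_of_nonneg_left ha) hV
  have hw' : w ≤ Wt / (θ / psq) := by rw [le_div_iff₀ hm]; linarith [hqw]
  have hinv : Wt / (θ / psq) = Wt * (psq / θ) := by rw [div_div_eq_mul_div, mul_div_assoc]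
  have hwle : w ≤ Wt * (2 * β * P) := by
    rw [hinv] at hw'
    exact hw'.trans (mul_le_mul_of_nonneg_left hthr hWt)
  have hale : a ≤ Wt := le_trans (le_add_of_nonneg_right (mul_nonneg hm.le hw)) hV
  -- the marginal part
  have htr : ∀ g : ↥(Matrix.specialUnitaryGroup (Fin 2) ℂ), |reTr g| ≤ 1 := fun g => RegularGaugeGroup.abs_reTr_le_one g
  have hmarg : |(∑ p, c p * (1 - reTr (GaugeField.plaqHol U p))) - (∑ p, c p * (1 - reTr (GaugeField.plaqHol V p)))| ≤ P * (a * 2) := by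
    rw [← Finset.sum_sub_distrib]
    refine (Finset.abs_sum_le_sum_abs _ _).trans ?_
    have hterm : ∀ p ∈ (Finset.univ : Finset (Plaq (F.P j) 0)),
        |c p * (1 - reTr (GaugeField.plaqHol U p)) - c p * (1 - reTr (GaugeField.plaqHol V p))| ≤ a * 2 := by
      intro p _
      rw [← mul_sub, abs_mul]
      have h1 := htr (GaugeField.plaqHol U p)
      have h2 := htr (GaugeField.plaqHol V p)
      have hdiff : |(1 - reTr (GaugeField.plaqHol U p)) - (1 - reTr (GaugeField.plaqHol V p))| ≤ 2 := by
        rw [abs_le] at h1 h2 ⊢; constructor <;> linarith [h1.1, h1.2, h2.1, h2.2]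
      exact mul_le_mul (hc p) hdiff (abs_nonneg _) ha
    refine (Finset.sum_le_sum hterm).trans ?_
    rw [Finset.sum_const, Finset.card_univ, nsmul_eq_mul]
  -- the degenerate four-point instance `(U, V, U, U)`
  have hq : Real.exp (-(κ * (b.src.tdist b.src : ℝ))) ≤ 1 :=
    Real.exp_le_one_iff.mpr (neg_nonpos.mpr (mul_nonneg hκ (Nat.cast_nonneg _)))
  have h := h4 b b U V U U hU hVV hU hU hUV (fun e _ => rfl) (fun e he => (hUV e he).symm) (fun e _ => rfl)
  rw [sub_self, sub_zero] at h
  have hxy : |Real.log (ρ U) - Real.log (ρ' U) - β * ∑ p, c p * (1 - reTr (GaugeField.plaqHol U p)) -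
      (Real.log (ρ V) - Real.log (ρ' V) - β * ∑ p, c p * (1 - reTr (GaugeField.plaqHol V p)))| ≤ w :=
    h.trans (mul_le_of_le_one_right hw hq)
  have e : (Real.log (ρ U) - Real.log (ρ' U)) - (Real.log (ρ V) - Real.log (ρ' V)) =
      (Real.log (ρ U) - Real.log (ρ' U) - β * ∑ p, c p * (1 - reTr (GaugeField.plaqHol U p)) -
        (Real.log (ρ V) - Real.log (ρ' V) - β * ∑ p, c p * (1 - reTr (GaugeField.plaqHol V p)))) +
      β * ((∑ p, c p * (1 - reTr (GaugeField.plaqHol U p))) - (∑ p, c p * (1 - reTr (GaugeField.plaqHol V p)))) := by ring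
  rw [e]
  refine (abs_add_le _ _).trans ?_
  rw [abs_mul, abs_of_nonneg hβ]
  have hWθ : 0 ≤ 2 * Wt * (1 / θ') := by positivity
  calc |Real.log (ρ U) - Real.log (ρ' U) - β * ∑ p, c p * (1 - reTr (GaugeField.plaqHol U p)) -
          (Real.log (ρ V) - Real.log (ρ' V) - β * ∑ p, c p * (1 - reTr (GaugeField.plaqHol V p)))| +
        β * |(∑ p, c p * (1 - reTr (GaugeField.plaqHol U p))) - (∑ p, c p * (1 - reTr (GaugeField.plaqHol V p)))|
      ≤ Wt * (2 * β * P) + β * (P * (Wt * 2)) := by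
        refine add_le_add (hxy.trans hwle) (mul_le_mul_of_nonneg_left (hmarg.trans ?_) hβ)
        exact mul_le_mul_of_nonneg_left (by linarith) hP
    _ = 2 * Wt * (2 * β * P) := by ring
    _ ≤ 2 * Wt * (1 / θ') + 2 * Wt * (2 * β * P) := le_add_of_nonneg_left hWθ
    _ = 2 * Wt * (1 / θ' + 2 * ((F.L : ℝ) ^ j / γ) * (Fintype.card (Plaq (F.P j) 0) : ℝ)) := by
        simp only [hβdef, hPdef]; ring

end Summit.QuantumFields.YangMills.Theorems.FluctuationComparisonRegPrIntL.RunPairOrgan
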